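import Literature.AlgebraicGeometry.HodgeTheory.AffineBasicOpenCoordinates
import Literature.AlgebraicGeometry.HodgeTheory.AnalyticModelOpenSubscheme
import HarnessLib

/-!
# Grothendieck's comparison map restricts to basic opens

[topic AlgebraicGeometry/HodgeTheory]

Let `Y` be a smooth affine `ℂ`-scheme with an analytic model `A` (`Y^an = A.carrier`), coordinates
`x : Fin N → Γ(Y, 𝒪)` (`φ_x = coordPresentation Y x`), and `g ∈ Γ(Y, 𝒪)`; let `Y_g = Y|_{D(g)}`
(`Motives.openSubschemeOver Y (Y.basicOpen g)`, open immersion `ι`), with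

* its analytic model `A.restrictOpen D(g)` — the open piece `ψ⁻¹(D(g)(ℂ)) ⊆ Y^an`
  (`AnalyticModelOpenSubscheme`: `(Y|_O)^h = ψ⁻¹(O) ⊂ Y^h`, [SerreGAGA1956, §2 n°5]), which this
  file identifies with the non-vanishing locus `{g^an ≠ 0}` (`AnalyticModel.mem_openSet_basicOpen_iff`);
* its coordinates `x' = (ι^* x, (ι^* g)⁻¹) = basicOpenCoord x g` and the polynomial lift
  `Tⱼ ↦ Tⱼ = basicOpenLift N` of `ι` (`AffineBasicOpenCoordinates`, [Hartshorne1977, II Prop. 2.2 (b)]).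

Feeding these data (`appTop_eq_coordPresentation_basicOpenCoord` = the lift hypothesis `hF`,
`anMap_restrictOpen_ι : ι^an = Subtype.val`) into the naturality of Grothendieck's comparison map
[Grothendieck1966, (5)] proved in `RegularFormRealizationNaturality` (`polyFormRealize_pullback_anMap`,
`regularFormRealize_pullback_anMap`, `deRhamComparison_map_eq`) gives the **restriction square** of
the comparison map to a basic open — the maps between the columns of the Čech–de Rham realisation
over an affine open cover [Grothendieck1966, p. 96 (6)]:

* `AnalyticModel.regularFun_basicOpenCoord_last_mul` — `(x'_N)^an · g^an = 1` on the open piece;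
* `polyFormRealize_basicOpenCoord_comap` — `(α(T₀, …, T_{N-1}))^an on Y_g^an = (α^an)|_{Y_g^an}`:
  `polyFormRealize (A.restrictOpen D(g)) x' p (F^* α) = (polyFormRealize A x p α)|_{ψ⁻¹ D(g)}`;
* `regularFormRealize_basicOpenCoord_comap` — the same for regular forms on `V(I) ⊇ Y`, `V(I') ⊇ Y_g`;
* `deRhamComparison_basicOpenCoord_comap` / `deRhamComparison_comp_comap_basicOpenLift` — on
  cohomology: `deRhamComparison_{Y_g} ∘ F^* = (restriction to the open piece) ∘ deRhamComparison_Y`.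

Everything is proved (0 definitions, 0 named facts, net debt 0).

## References

* [Grothendieck1966] A. Grothendieck, *On the de Rham cohomology of algebraic varieties*, Publ.
  Math. IHÉS 29 (1966), p. 96 (4)–(6).
* [SerreGAGA1956] J.-P. Serre, *Géométrie algébrique et géométrie analytique*, Ann. Inst. Fourier 6
  (1956), §2 n°5.
* [Hartshorne1977] R. Hartshorne, *Algebraic Geometry*, II Prop. 2.2 (b), II §3.
-/

noncomputable section

open scoped Manifold ContDiff
open CategoryTheory AlgebraicGeometry MvPolynomial
open Literature.NumberTheory.Transcendental Literature.Geometry.Kaehler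
open Literature.AlgebraicGeometry.Motives Literature.AlgebraicGeometry.Motives.AffineDeRham

namespace Literature.AlgebraicGeometry.HodgeTheory

section HodgeTheory

variable {E : Type} [NormedAddCommGroup E] [NormedSpace ℂ E] [FiniteDimensional ℂ E] {m : ℕ}
  {Y : Motives.SchemeOver ℂ} (A : AnalyticModel E m Y) {N : ℕ}

namespace AnalyticModel

/-! ### The open piece over `D(g)` is the non-vanishing locus of `g^an` -/

/-- **`ψ⁻¹(D(g)(ℂ)) = {g^an ≠ 0}`**: a point of `Y^an` lies in the open piece over the basic open
`D(g)` iff the holomorphic function `g^an` does not vanish there (`P ∈ D(g) ⟺ g(P) ≠ 0`).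
[cite: Hartshorne1977, II §2 (D(f))] [cite: SerreGAGA1956, §2 n°5] -/
theorem mem_openSet_basicOpen_iff (g : Γ(Y.left, ⊤)) (z : A.carrier) :
    z ∈ A.openSet (Y.left.basicOpen g) ↔ A.regularFun g z ≠ 0 := by
  rw [A.mem_openSet_iff, AlgPoints.pt_mem_basicOpen_iff (A.toComplexPoints z) (U := ⊤) trivial g]
  simp only [AnalyticModel.regularFun, AlgPoints.evalOrZero_of_mem g (trivial : (A.toComplexPoints z).pt ∈ ⊤)]

/-- The open piece over `D(g)`, as a set, is `{z | g^an(z) ≠ 0}`. [cite: SerreGAGA1956, §2 n°5] -/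
theorem coe_openSet_basicOpen (g : Γ(Y.left, ⊤)) :
    (A.openSet (Y.left.basicOpen g) : Set A.carrier) = {z | A.regularFun g z ≠ 0} :=
  Set.ext fun z ↦ A.mem_openSet_basicOpen_iff g z

/-- `g^an` does not vanish on the open piece over `D(g)`. [cite: SerreGAGA1956, §2 n°5] -/
theorem regularFun_ne_zero_of_mem_openSet (g : Γ(Y.left, ⊤)) (z : A.openSet (Y.left.basicOpen g)) :
    A.regularFun g (z : A.carrier) ≠ 0 :=
  (A.mem_openSet_basicOpen_iff g z).1 z.2

/-- The inclusion of an open piece `ψ⁻¹(O(ℂ)) ↪ Y^an` is real smooth. [cite: SerreGAGA1956, §2 n°5] -/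
theorem contMDiff_subtypeVal_openSet (O : Y.left.Opens) :
    ContMDiff 𝓘(ℝ, E) 𝓘(ℝ, E) ∞ (Subtype.val : A.openSet O → A.carrier) :=
  contMDiff_subtype_val

variable [IsAffine Y.left] (x : Fin N → Γ(Y.left, ⊤)) (g : Γ(Y.left, ⊤))

/-! ### The coordinates of `Y_g` read on the open piece -/

/-- The first `N` coordinates of `Y_g` read on the open piece are the restrictions of the `xⱼ^an`.
[cite: SerreGAGA1956, §2 n°5] -/
theorem regularFun_basicOpenCoord_castSucc (j : Fin N) :
    (A.restrictOpen (Y.left.basicOpen g)).regularFun (basicOpenCoord x g (Fin.castSucc j)) =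
      A.regularFun (x j) ∘ (Subtype.val : A.openSet (Y.left.basicOpen g) → A.carrier) := by
  rw [basicOpenCoord_castSucc, regularFun_restrictOpen_appTop]

/-- **`(x'_N)^an · g^an = 1` on the open piece**: the last coordinate of `Y_g` analytifies to `1/g^an`.
[cite: Hartshorne1977, II Prop. 2.2 (b)] [cite: SerreGAGA1956, §2 n°5] -/
theorem regularFun_basicOpenCoord_last_mul (z : A.openSet (Y.left.basicOpen g)) :
    (A.restrictOpen (Y.left.basicOpen g)).regularFun (basicOpenCoord x g (Fin.last N)) z *
      A.regularFun g (z : A.carrier) = 1 := by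
  have h := congrArg (fun s ↦ (A.restrictOpen (Y.left.basicOpen g)).regularFun s z)
    (basicOpenCoord_last_mul x g)
  simp only at h
  rwa [regularFun_mul_apply, regularFun_restrictOpen_appTop, regularFun_one', Function.comp_apply] at h

/-- `(x'_N)^an = (g^an)⁻¹` on the open piece. [cite: Hartshorne1977, II Prop. 2.2 (b)] [cite: SerreGAGA1956, §2 n°5] -/
theorem regularFun_basicOpenCoord_last (z : A.openSet (Y.left.basicOpen g)) :
    (A.restrictOpen (Y.left.basicOpen g)).regularFun (basicOpenCoord x g (Fin.last N)) z =
      (A.regularFun g (z : A.carrier))⁻¹ :=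
  eq_inv_of_mul_eq_one_left (A.regularFun_basicOpenCoord_last_mul x g z)

/-- Polynomials in the first `N` coordinates of `Y_g` read on the open piece:
`(φ_{x'}(f(T₀, …, T_{N-1})))^an = (φ_x f)^an|_{ψ⁻¹ D(g)}`. [cite: SerreGAGA1956, §2 n°5] -/
theorem regularFun_coordPresentation_basicOpenCoord_bind₁ (f : MvPolynomial (Fin N) ℂ) :
    (A.restrictOpen (Y.left.basicOpen g)).regularFun
        (coordPresentation _ (basicOpenCoord x g) (bind₁ (basicOpenLift N) f)) =
      A.regularFun (coordPresentation Y x f) ∘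
        (Subtype.val : A.openSet (Y.left.basicOpen g) → A.carrier) := by
  rw [coordPresentation_basicOpenCoord_bind₁, regularFun_restrictOpen_appTop]

end AnalyticModel

variable [IsAffine Y.left] [SmoothOfRelativeDimension m Y.hom] (x : Fin N → Γ(Y.left, ⊤))
  (g : Γ(Y.left, ⊤))

/-! ### The restriction square of Grothendieck's comparison map -/

/-- **Holomorphic images of polynomial forms restrict**: on the open piece over `D(g)`, the
holomorphic image for the coordinates `x'` of the substituted form `α(T₀, …, T_{N-1})` is the
restriction of the holomorphic image of `α` — `polyFormRealize_pullback_anMap` for `ι : Y_g ⟶ Y`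
with `ι^an = Subtype.val`. [cite: Grothendieck1966, (5)] -/
theorem polyFormRealize_basicOpenCoord_comap {p : ℕ} (α : PolyForm ℂ N p) :
    polyFormRealize (A.restrictOpen (Y.left.basicOpen g)) (basicOpenCoord x g) p
        (PolyForm.comap (basicOpenLift N) α) =
      (polyFormRealize A x p α).pullback 𝓘(ℝ, E)
        (Subtype.val : A.openSet (Y.left.basicOpen g) → A.carrier) := by
  rw [← A.anMap_restrictOpen_ι (Y.left.basicOpen g)]
  exact (polyFormRealize_pullback_anMap (A.restrictOpen (Y.left.basicOpen g)) A
    (Motives.openSubschemeOverι Y (Y.left.basicOpen g))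
    (appTop_eq_coordPresentation_basicOpenCoord x g) α).symm

/-- **Holomorphic images of regular forms restrict**: for relations `I ⊆ ker φ_x` of `Y` and
`I' ⊆ ker φ_{x'}` of `Y_g` with `I · ℂ[T₀, …, T_N] ⊆ I'`, and a regular `p`-form `r` on `V(I)`,
`((F^* r))^an on Y_g^an = (r^an)|_{Y_g^an}`. [cite: Grothendieck1966, (5)] -/
theorem regularFormRealize_basicOpenCoord_comap
    {I : Ideal (MvPolynomial (Fin N) ℂ)} {I' : Ideal (MvPolynomial (Fin (N + 1)) ℂ)}
    (hI : I ≤ RingHom.ker (coordPresentation Y x))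
    (hI' : I' ≤ RingHom.ker (coordPresentation _ (basicOpenCoord x g)))
    (hFI : I.map (bind₁ (basicOpenLift N) : MvPolynomial (Fin N) ℂ →ₐ[ℂ] MvPolynomial (Fin (N + 1)) ℂ) ≤ I')
    (p : ℕ) (r : RegularForm I p) :
    regularFormRealize (A.restrictOpen (Y.left.basicOpen g)) (basicOpenCoord x g) hI' p
        (RegularForm.comap (basicOpenLift N) hFI p r) =
      (regularFormRealize A x hI p r).pullback 𝓘(ℝ, E)
        (Subtype.val : A.openSet (Y.left.basicOpen g) → A.carrier) := by
  rw [← A.anMap_restrictOpen_ι (Y.left.basicOpen g)]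
  exact (regularFormRealize_pullback_anMap (A.restrictOpen (Y.left.basicOpen g)) A
    (Motives.openSubschemeOverι Y (Y.left.basicOpen g))
    (appTop_eq_coordPresentation_basicOpenCoord x g) hI' hI hFI p r).symm

/-- **Grothendieck's comparison map restricts to basic opens** (on classes): for every algebraic
de Rham class `c` of `V(I)`,
`deRhamComparison_{Y_g} (F^* c) = (restriction to ψ⁻¹ D(g)) (deRhamComparison_Y c)` — the square
relating the comparison maps of `Y` and of its basic open `Y_g` [Grothendieck1966, p. 96: (5) is
compatible with the Čech differentials of an affine open cover, (6)]. The smoothness witness of the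
inclusion is arbitrary (`AnalyticModel.contMDiff_subtypeVal_openSet`). [cite: Grothendieck1966, (5)–(6)] -/
theorem deRhamComparison_basicOpenCoord_comap
    (hval : ContMDiff 𝓘(ℝ, E) 𝓘(ℝ, E) ∞ (Subtype.val : A.openSet (Y.left.basicOpen g) → A.carrier))
    {I : Ideal (MvPolynomial (Fin N) ℂ)} {I' : Ideal (MvPolynomial (Fin (N + 1)) ℂ)}
    (hI : I ≤ RingHom.ker (coordPresentation Y x))
    (hI' : I' ≤ RingHom.ker (coordPresentation _ (basicOpenCoord x g)))
    (hFI : I.map (bind₁ (basicOpenLift N) : MvPolynomial (Fin N) ℂ →ₐ[ℂ] MvPolynomial (Fin (N + 1)) ℂ) ≤ I')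
    (p : ℕ) (c : DeRhamCohomology I p) :
    deRhamComparison (A.restrictOpen (Y.left.basicOpen g)) (basicOpenCoord x g) hI' p
        (DeRhamCohomology.comap (basicOpenLift N) hFI p c) =
      complexDeRhamCohomology.map E hval p (deRhamComparison A x hI p c) := by
  -- replace the inclusion by `ι^an` (same function), the witness being irrelevant
  have key : ∀ (f : A.openSet (Y.left.basicOpen g) → A.carrier) (hf : ContMDiff 𝓘(ℝ, E) 𝓘(ℝ, E) ∞ f),
      f = (A.restrictOpen (Y.left.basicOpen g)).anMap A
        (Motives.openSubschemeOverι Y (Y.left.basicOpen g)) →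
      complexDeRhamCohomology.map E hf p (deRhamComparison A x hI p c) =
        deRhamComparison (A.restrictOpen (Y.left.basicOpen g)) (basicOpenCoord x g) hI' p
          (DeRhamCohomology.comap (basicOpenLift N) hFI p c) := by
    rintro _ hf rfl
    exact deRhamComparison_map_eq (A.restrictOpen (Y.left.basicOpen g)) A
      (Motives.openSubschemeOverι Y (Y.left.basicOpen g))
      (appTop_eq_coordPresentation_basicOpenCoord x g) hI' hI hFI p c
  exact (key Subtype.val hval (A.anMap_restrictOpen_ι (Y.left.basicOpen g)).symm).symm

/-- The restriction square as an identity of linear maps: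
`deRhamComparison_{Y_g} ∘ F^* = (restriction) ∘ deRhamComparison_Y`. [cite: Grothendieck1966, (5)–(6)] -/
theorem deRhamComparison_comp_comap_basicOpenLift
    (hval : ContMDiff 𝓘(ℝ, E) 𝓘(ℝ, E) ∞ (Subtype.val : A.openSet (Y.left.basicOpen g) → A.carrier))
    {I : Ideal (MvPolynomial (Fin N) ℂ)} {I' : Ideal (MvPolynomial (Fin (N + 1)) ℂ)}
    (hI : I ≤ RingHom.ker (coordPresentation Y x))
    (hI' : I' ≤ RingHom.ker (coordPresentation _ (basicOpenCoord x g)))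
    (hFI : I.map (bind₁ (basicOpenLift N) : MvPolynomial (Fin N) ℂ →ₐ[ℂ] MvPolynomial (Fin (N + 1)) ℂ) ≤ I')
    (p : ℕ) :
    deRhamComparison (A.restrictOpen (Y.left.basicOpen g)) (basicOpenCoord x g) hI' p ∘ₗ
        DeRhamCohomology.comap (basicOpenLift N) hFI p =
      complexDeRhamCohomology.map E hval p ∘ₗ deRhamComparison A x hI p :=
  LinearMap.ext fun c ↦ deRhamComparison_basicOpenCoord_comap A x g hval hI hI' hFI p c

/-- The restriction square for the CANONICAL relations: `I ⊆ ker φ_x` on `Y` and its extension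
`I · ℂ[T₀, …, T_N]` on `Y_g` (`map_basicOpenLift_le_ker_coordPresentation_basicOpenCoord`).
[cite: Grothendieck1966, (5)–(6)] -/
theorem deRhamComparison_basicOpenCoord_comap_map
    (hval : ContMDiff 𝓘(ℝ, E) 𝓘(ℝ, E) ∞ (Subtype.val : A.openSet (Y.left.basicOpen g) → A.carrier))
    {I : Ideal (MvPolynomial (Fin N) ℂ)} (hI : I ≤ RingHom.ker (coordPresentation Y x)) (p : ℕ)
    (c : DeRhamCohomology I p) :
    deRhamComparison (A.restrictOpen (Y.left.basicOpen g)) (basicOpenCoord x g)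
        (map_basicOpenLift_le_ker_coordPresentation_basicOpenCoord x g hI) p
        (DeRhamCohomology.comap (basicOpenLift N) le_rfl p c) =
      complexDeRhamCohomology.map E hval p (deRhamComparison A x hI p c) :=
  deRhamComparison_basicOpenCoord_comap A x g hval hI _ le_rfl p c

end HodgeTheory

end Literature.AlgebraicGeometry.HodgeTheory

end
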